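import Summits.AtomisticToContinuum.FouriersLaw.Theses.EmbeddedDrudeMourre
import Summits.AtomisticToContinuum.FouriersLaw.Theses.FourierGreenKubo
import Literature.MathematicalPhysics.KineticTheory.InfiniteChainInvariantStates
import Literature.MathematicalPhysics.KineticTheory.InfiniteChainAbelWitness
import Literature.MathematicalPhysics.KineticTheory.ZeroWavenumberSpace

/-!
# Line `overlap-rigidity-analytic-continuation` — crux `EmbeddedDrudeMourre.GreenKuboContinuation`
(stmt-AtomisticToContinuum-12597)

Skeleton (crux-plan, round 1) of the crux idea card `overlap-rigidity-analytic-continuation`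
(ideator 1; triage r1: pass × 3 with sharpenings, see the line card `Lines/….md`).

THE CRUX (`greenKuboContinuation_iff_continuesAlong`, `Iff.rfl`): for `pinnedChain ω₂ lam β γ`
(all four `> 0`) and every `T₀ > 0`, Abelian Green–Kubo witnesses `AbelWitness … T` at every
`T ∈ (0, T₀)` (the KINETIC CORNER) imply witnesses at every `T > 0`.

THE LEVER (atom branch). For every temperature-independent LOCAL conservation law of the fixed
chain, `𝒜Q = G ∘ shift − G` (`Q`, `G` local polynomials, `𝒜 = liouvilleZ`), the Mazur overlap of
the energy current with `Q` in Doyon's zero-wavenumber form `⟨f, g⟩₀ = Σ_x Cov_μ(f, g ∘ τ_x)` has two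
exact STATIC faces at a symmetric Gibbs state `μ_T`:
  `⟨j₀, Q⟩₀ = −⟨h₀, G⟩₀`      (current–charge symmetry; `stub_currentChargeSymmetry`)
  `⟨h₀, G⟩₀ = T² · d⟨G⟩_T/dT`  (fluctuation–response along the Gibbs family; `stub_symmetricGibbsFamily`).
`Q, G` do not depend on `T`; `T ↦ ⟨G⟩_T` is REAL-ANALYTIC on `(0, ∞)` for the 1-D nearest-neighbour
chain (positive Hilbert–Schmidt transfer operator, simple top eigenvalue, Kato;
`stub_localExpectationAnalytic`, which also carries uniqueness of the translation-invariant DLR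
state). On the corner the crux's OWN HYPOTHESIS kills the overlap (`stub_cornerOrthogonality`:
Abel-summable `C_T` ⇒ no Drude floor ⇒ `[j] ⊥` every conserved vector of `ℋ₀(μ_T)`, Mazur — tree
`Mazur1969_inequality`, Disproof §2c `not_tendsto_of_drude_floor`). Hence `d⟨G⟩_T/dT = 0` on
`(0, T₀)`, so by the identity theorem (PROVED here: `form₀_energy_flux_eq_zero`,
`noLocalOverlap_allT`) `⟨j₀, Q⟩₀ = 0` at EVERY `T > 0`: no local conservation law can make the
current ballistic anywhere on the ray — without classifying local charges
(NoHiddenChargesKubo's `LocalChargeClassification`, stmt-11914, is bypassed for transport).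

THE TRANSFER (regular branch, named residuals = the card's `C⁺`): `stub_zeroDrudeOfNoLocalOverlap`
(completeness of local charges at the current: no local overlap ⇒ zero Cesàro–Drude weight of `C_T`
for every symmetric dynamics; = NoHiddenChargesKubo's `ChargeCompleteness` stmt-11915 at `f = j₀`,
with `GibbsClustering` 11913 / `DrudeWeightExists` 11916) and `stub_abelWitnessOfZeroDrude` (THE
HARDEST, import slot: zero Drude weight at a symmetric Gibbs state ⇒ an Abelian witness; the
Abelian reading of `GreenKuboOfNoDrude` stmt-11029 / `FourierGreenKubo` stmt-0703, also the output
of the route's own Mourre engine in non-perturbative form and of the sibling modulus line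
heated-measure-thermal-exponent ≈ temperature-blind-vitali-hurwitz).

Composition (sorry-free): `form₀_energy_flux_eq_zero` → `noLocalOverlap_allT` →
`continuesAlong_of_parts` → `continuesAlong_of_statements` (arrow form over the six statement
`def`s) → `GreenKuboContinuation_of` (no hypotheses; feeds the six `stub_*` into the statement-typed
slots and concludes the route decl BY NAME via `greenKuboContinuation_iff_continuesAlong`).
Disproof.lean honoured: analyticity not smoothness (§6 `corner_vanishing_not_smooth_rigid`) is what
`stub_localExpectationAnalytic` supplies; the corner is USED (§2c), not discarded (§4/§5: no stub is
`AbelianGreenKuboAllT` or its unit-temperature slice); `stub_abelWitnessOfZeroDrude` must deliver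
`κ > 0`, not mere continuity (§6 `no_witness_of_pseudogap`). No `_false_without_` theorem exists in
Disproof.lean (2026-08-15 tree copy); no Negative lemma has landed for this crux.
-/

noncomputable section

open MeasureTheory Filter Set Topology
open Literature.MathematicalPhysics.KineticTheory.HeatConduction
open Summit.AtomisticToContinuum.FouriersLaw.Theses.EmbeddedDrudeMourre (GreenKuboContinuation)

namespace Summit.AtomisticToContinuum.FouriersLaw.Cruxes.GreenKuboContinuation.OverlapRigidityAnalyticContinuation

/-! ## 0. Vocabulary (verbatim the conventions of the NoHiddenChargesKubo items 11913–11916, 11029, 11036) -/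

/-- LOCAL POLYNOMIAL observable: a real polynomial in finitely many coordinates `q_{a+i}, p_{a+i}`,
`i ≤ n` (the `LocPoly` of `NoHiddenChargesKubo.LocalChargeClassification` / `ChargeCompleteness`,
token for token). -/
def IsLocPoly (f : ChainConfig → ℝ) : Prop :=
  ∃ (a : ℤ) (n : ℕ) (w : MvPolynomial (Fin (n + 1) × Bool) ℝ), ∀ σ, f σ =
    MvPolynomial.eval (fun v : Fin (n + 1) × Bool =>
      if v.2 then (boxRestrictAt a n σ v.1).2 else (boxRestrictAt a n σ v.1).1) w

/-- LOCAL CONSERVATION LAW WITH FLUX: `𝒜Q = G ∘ shift − G` pointwise (`𝒜 = liouvilleZ P`; the `Cons`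
relation of `ChargeCompleteness`, with the flux `G` kept explicit because the lever reads it). -/
def IsFluxPair (P : OscillatorChain) (Q G : ChainConfig → ℝ) : Prop :=
  ∀ σ, liouvilleZ P Q σ = G (shift σ) - G σ

/-- Momentum-reversal invariance of a state, `μ ∘ R⁻¹ = μ`, `(Rσ)_x = (q_x, −p_x)` (spelled as in the
NoHiddenChargesKubo items). -/
def IsReversalInvariant (μ : Measure ChainConfig) : Prop :=
  μ.map (fun σ : ChainConfig => fun x : ℤ => ((σ x).1, -(σ x).2)) = μ

/-- Static connected correlation at lattice distance `x`: `Cov_μ(f, g ∘ τ_x)` (the `Cov f g 0 x` of the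
NoHiddenChargesKubo items without the flow). -/
def scov (μ : Measure ChainConfig) (f g : ChainConfig → ℝ) (x : ℤ) : ℝ :=
  (∫ σ, f σ * g (fun y => σ (y + x)) ∂μ) - (∫ σ, f σ ∂μ) * ∫ σ, g (fun y => σ (y + x)) ∂μ

/-- Doyon's zero-wavenumber form on local observables, `⟨f, g⟩₀ = Σ_{x ∈ ℤ} Cov_μ(f, g ∘ τ_x)`
(`ZeroWavenumberData.form_eq_tsum`; `tsum`, junk `0` when not summable — summability is part of
`HasStatics`). -/
def form₀ (μ : Measure ChainConfig) (f g : ChainConfig → ℝ) : ℝ :=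
  ∑' x : ℤ, scov μ f g x

/-- The bond energy current `j₀` of the chain `P` as an observable. -/
def current₀ (P : OscillatorChain) : ChainConfig → ℝ := fun σ => P.bondCurrentZ σ 0

/-- The (symmetrically split) energy density `h₀` of the chain `P` as an observable
(`OscillatorChain.energyDensityZ`, whose local conservation law `ḣ₀ = j₋₁ − j₀` is the tree's
`IsSolution.hasDerivAt_energyDensityZ`). -/
def energy₀ (P : OscillatorChain) : ChainConfig → ℝ := fun σ => P.energyDensityZ σ 0

/-- STATIC REGULARITY PACKAGE of a state `μ` for the chain `P`: local polynomials are square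
integrable; STATIC KMS / stationarity in generator form on local polynomials (`∫ 𝒜F dμ = 0`, with
`𝒜F` integrable); FIRST-MOMENT clustering `Σ_x (1 + |x|)·|Cov_μ(a, b ∘ τ_x)| < ∞` of local polynomials
(what the summation by parts in the current–charge symmetry needs). -/
def HasStatics (P : OscillatorChain) (μ : Measure ChainConfig) : Prop :=
  (∀ f : ChainConfig → ℝ, IsLocPoly f → MemLp f 2 μ) ∧
  (∀ F : ChainConfig → ℝ, IsLocPoly F → Integrable (liouvilleZ P F) μ ∧ ∫ σ, liouvilleZ P F σ ∂μ = 0) ∧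
  (∀ a b : ChainConfig → ℝ, IsLocPoly a → IsLocPoly b →
    Summable fun x : ℤ => (1 + |(x : ℝ)|) * |scov μ a b x|)

/-- SYMMETRIC GIBBS STATE at temperature `T`: DLR for `P` at `T`, translation invariant, momentum-reversal
invariant (the state half of NoHiddenChargesKubo's "symmetric set-up", `SymmetricSetup` stmt-11036). -/
def IsSymmetricGibbs (P : OscillatorChain) (T : ℝ) (μ : Measure ChainConfig) : Prop :=
  P.IsChainGibbsMeasure T μ ∧ IsShiftInvariant μ ∧ IsReversalInvariant μ

/-- SYMMETRIC DYNAMICS for the state `μ`: a `μ`-preserving infinite-volume dynamics whose flow commutes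
with the shift `μ`-a.e. (the dynamics half of the "symmetric set-up"). -/
def IsSymmetricDynamics (P : OscillatorChain) (μ : Measure ChainConfig) (D : InfiniteChainDynamics P) :
    Prop :=
  D.PreservesMeasure μ ∧ ∀ t : ℝ, ∀ᵐ σ ∂μ, D.flow t (shift σ) = shift (D.flow t σ)

/-- `W T`: an ABELIAN GREEN–KUBO WITNESS of `pinnedChain ω₂ lam β γ` at temperature `T` — verbatim the
predicate that both the hypothesis (for `T < T₀`) and the conclusion (for all `T > 0`) of the crux
assert (same text as `Disproof.AbelWitness`; `greenKuboContinuation_iff_continuesAlong` is `Iff.rfl`). -/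
def AbelWitness (ω₂ lam β γ T : ℝ) : Prop :=
  ∃ (μT : Measure ChainConfig) (D : InfiniteChainDynamics (pinnedChain ω₂ lam β γ)) (κ : ℝ),
    (pinnedChain ω₂ lam β γ).IsChainGibbsMeasure T μT ∧ D.PreservesMeasure μT ∧
      (∀ t : ℝ, D.HasAbsConvergentCorrelation μT t) ∧ 0 < κ ∧
        Tendsto (fun ν : ℝ => (T ^ 2)⁻¹ * ∫ t in Ioi (0 : ℝ),
          Real.exp (-(ν * t)) * D.currentCorrelation μT t) (𝓝[>] (0 : ℝ)) (𝓝 κ)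

/-- The crux read back: continuation of `AbelWitness` from every initial temperature segment
(definitional unfolding). -/
theorem greenKuboContinuation_iff_continuesAlong :
    GreenKuboContinuation ↔ ∀ ω₂ lam β γ : ℝ, 0 < ω₂ → 0 < lam → 0 < β → 0 < γ → ∀ T₀ : ℝ, 0 < T₀ →
      (∀ T : ℝ, 0 < T → T < T₀ → AbelWitness ω₂ lam β γ T) → ∀ T : ℝ, 0 < T → AbelWitness ω₂ lam β γ T :=
  Iff.rfl

/-! ## 1. The six statements of the line -/

/-- Statement of `stub_currentChargeSymmetry` — CURRENT–CHARGE SYMMETRY (static Tóth–Valkó / Grisi–Schütz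
/ Spohn `AC = CAᵀ` / Doyon flux-Jacobian symmetry, purely static form; size M, provable now): for a
translation-invariant probability state `μ` of the pinned chain with the static package `HasStatics`
(square-integrable local polynomials, `∫ 𝒜F dμ = 0` on local polynomials, first-moment clustering) and
every local conservation law `𝒜Q = G ∘ shift − G` with local polynomial `Q, G`:
`Σ_x Cov_μ(j₀, Q ∘ τ_x) = − Σ_x Cov_μ(h₀, G ∘ τ_x)`.
Proof plan (triage A1): `Cov(𝒜a, b) = −Cov(a, 𝒜b)` from `∫ 𝒜(ab) dμ = 0` (Leibniz for `liouvilleZ` on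
polynomials), with `a_N = Σ_{|y|≤N} y·h_y`, `𝒜h_y = j_{y−1} − j_y` (tree `IsSolution.hasDerivAt_energyDensityZ`
in generator form), `𝒜Q₀ = G₁ − G₀`, shift invariance and summation by parts; the boundary terms
`N·Cov(j_{±N}, Q₀)` die by first-moment clustering. Sanity: `Q = h₀`, `G = −j₋₁` gives `⟨j, h⟩₀ = ⟨h, j⟩₀`
(`= 0` by parity). No dynamics is used. -/
def CurrentChargeSymmetry : Prop :=
  ∀ ω₂ lam β γ : ℝ, 0 < ω₂ → 0 < lam → 0 < β → ∀ μ : Measure ChainConfig,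
    IsProbabilityMeasure μ → IsShiftInvariant μ → HasStatics (pinnedChain ω₂ lam β γ) μ →
    ∀ Q G : ChainConfig → ℝ, IsLocPoly Q → IsLocPoly G → IsFluxPair (pinnedChain ω₂ lam β γ) Q G →
      form₀ μ (current₀ (pinnedChain ω₂ lam β γ)) Q = - form₀ μ (energy₀ (pinnedChain ω₂ lam β γ)) G

/-- Statement of `stub_symmetricGibbsFamily` — THE SYMMETRIC GIBBS FAMILY AND ITS FLUCTUATION–RESPONSE
FORMULA (1-D transfer-operator statics; size L): for `ω₂, lam, β > 0` (any `γ`) there is a family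
`T ↦ μ_T` such that at every `T > 0`: `μ_T` is a DLR Gibbs state of `pinnedChain ω₂ lam β γ` at `T`,
translation and momentum-reversal invariant (transfer operator `e^{−U/2T} e^{−V(q′−q)/T} e^{−U/2T}`,
positive Hilbert–Schmidt; Gaussian momenta), with the static package `HasStatics` (all polynomial
moments; `∫ 𝒜F dμ_T = 0` from Liouville invariance of the finite-volume DLR kernels — tree
`measurePreserving_severedFlow_of_isChainGibbsMeasure` — differentiated at `t = 0`; exponential
clustering from the `L²` spectral gap `λ₁/λ₀ < 1` of the stationary Markov chain), and the
FLUCTUATION–RESPONSE identity along the family for every local polynomial `G`: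
`d/dS ∫ G dμ_S |_{S=T} = T⁻² Σ_x Cov_{μ_T}(h₀, G ∘ τ_x)` (`= T⁻² Σ_x Cov_T(h_x, G)`; differentiate the
DLR/transfer-operator expression of `⟨G⟩_T` in `T`, dominated convergence by the clustering). -/
def SymmetricGibbsFamily : Prop :=
  ∀ ω₂ lam β γ : ℝ, 0 < ω₂ → 0 < lam → 0 < β → ∃ μ : ℝ → Measure ChainConfig, ∀ T : ℝ, 0 < T →
    IsSymmetricGibbs (pinnedChain ω₂ lam β γ) T (μ T) ∧ HasStatics (pinnedChain ω₂ lam β γ) (μ T) ∧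
    ∀ G : ChainConfig → ℝ, IsLocPoly G →
      HasDerivAt (fun S : ℝ => ∫ σ, G σ ∂(μ S))
        ((T ^ 2)⁻¹ * form₀ (μ T) (energy₀ (pinnedChain ω₂ lam β γ)) G) T

/-- Statement of `stub_localExpectationAnalytic` — REAL-ANALYTICITY OF LOCAL EXPECTATIONS IN THE
TEMPERATURE, WITH UNIQUENESS OF THE TRANSLATION-INVARIANT GIBBS STATE BUILT IN (size L; the
load-bearing regularity: Disproof §6 `corner_vanishing_not_smooth_rigid` shows `C^∞` would not do):
for `ω₂, lam, β > 0` and EVERY family `T ↦ μ_T` of translation-invariant DLR states of the pinned chain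
(`T > 0`), `T ↦ ∫ G dμ_T` is real-analytic on `(0, ∞)` for every local polynomial `G`.
Content: (a) a translation-invariant DLR state at `T` is unique — its one-site marginal is tight, so
the boundary laws of the two-sided Markov field are tight and the positive Hilbert–Schmidt transfer
operator's spectral gap forces the canonical chain (uniqueness among ALL DLR probability states is
deliberately NOT claimed: mean-shifted exploding states `m_x = Aρ^x + Bρ^{−x}` exist already for the
harmonic chain); (b) for the canonical state, `β ↦ K_β` is real-analytic in Hilbert–Schmidt norm
(`sup_W W^{2k} e^{−βW} ≤ (2k/eβ)^{2k}`), the top eigenvalue is simple and isolated at every `β > 0`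
(Jentzsch / Krein–Rutman), so Kato perturbation theory makes `⟨G⟩_T = ⟨φ₀, M_G φ₀⟩`-type expressions
analytic (polynomial `G`: weighted spaces / analytic families of type (A)). Why it might fail: only
through (a) (an exotic translation-invariant DLR state at some `T`) — (b) is theorem-grade. -/
def LocalExpectationAnalytic : Prop :=
  ∀ ω₂ lam β γ : ℝ, 0 < ω₂ → 0 < lam → 0 < β → ∀ μ : ℝ → Measure ChainConfig,
    (∀ T : ℝ, 0 < T → (pinnedChain ω₂ lam β γ).IsChainGibbsMeasure T (μ T) ∧ IsShiftInvariant (μ T)) →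
    ∀ G : ChainConfig → ℝ, IsLocPoly G →
      AnalyticOnNhd ℝ (fun T : ℝ => ∫ σ, G σ ∂(μ T)) (Ioi 0)

/-- Statement of `stub_cornerOrthogonality` — THE CORNER IS USED: AN ABELIAN WITNESS AT `T` KILLS EVERY
LOCAL-CHARGE OVERLAP OF THE CURRENT IN THE SYMMETRIC GIBBS STATE AT `T` (Mazur at the corner; size L):
for all parameters `> 0` and `T > 0`, if `AbelWitness ω₂ lam β γ T` then for every symmetric Gibbs
state `μ` at `T` and every local conservation law `𝒜Q = G ∘ shift − G` (local polynomials),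
`Σ_x Cov_μ(j₀, Q ∘ τ_x) = 0`.
Proof plan: (i) the witness state `μ^w` IS `μ` — a DLR state carrying a conducting dynamics
(absolutely convergent current correlations at all times) is tempered, and tempered/translation-
invariant DLR states are unique (transfer operator; this identification is the stub's named risk:
the crux types its witnesses over arbitrary DLR states); (ii) the witness dynamics `D^w` preserves
`μ`, commutes with the shift `μ`-a.e. (conjugate by `τ_x`, LLL Thm 2/4 uniqueness in the growth
class, tree `InfiniteChainUniqueness`), and has space-time summable clustering on local polynomials
(finite-speed / `L²`-Lieb–Robinson estimates = NoHiddenChargesKubo's `GibbsClustering` 11913 for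
`D^w`) — so `(μ, D^w)` carries a `ZeroWavenumberData` with `U_t[Q] = [Q]` (class map ∘ time integral
of the pointwise law `𝒜Q = G∘shift − G`, telescoping); (iii) a finite Abel limit of
`(T²)⁻¹∫e^{−νt}C_T` forces `ν∫e^{−νt}C_T → 0`, hence (Cesàro ⇒ Abel for the positive-definite `C_T`,
tree `Mazur.tendsto_inv_mul_integral_inner`, `inner_currentClass_koopman_eq_currentCorrelation`)
`‖P_{𝒬₀}[j]‖² = 0`, i.e. `[j] ⊥ [Q]` (`Mazur1969_inequality`; Disproof §2c `not_tendsto_of_drude_floor`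
is the contrapositive), and `⟪[j],[Q]⟫₀ = Σ_x Cov_μ(j₀, Q∘τ_x)` (`form_eq_tsum`). For momentum-EVEN
`Q` the conclusion is free by parity (`j₀` odd, `μ` reversal invariant); the content is the ODD
sector (triage k2's `NoLocalOddChargeOverlap`). TRUE outright if `LocalChargeClassification`
(stmt-11914) holds — the corner route is this line's way to it without classification. -/
def CornerOrthogonality : Prop :=
  ∀ ω₂ lam β γ : ℝ, 0 < ω₂ → 0 < lam → 0 < β → 0 < γ → ∀ T : ℝ, 0 < T → AbelWitness ω₂ lam β γ T →
    ∀ μ : Measure ChainConfig, IsSymmetricGibbs (pinnedChain ω₂ lam β γ) T μ →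
    ∀ Q G : ChainConfig → ℝ, IsLocPoly Q → IsLocPoly G → IsFluxPair (pinnedChain ω₂ lam β γ) Q G →
      form₀ μ (current₀ (pinnedChain ω₂ lam β γ)) Q = 0

/-- Statement of `stub_zeroDrudeOfNoLocalOverlap` — COMPLETENESS OF LOCAL CHARGES AT THE CURRENT
(transfer conjunct 1; open problem SHARED with NoHiddenChargesKubo: = `ChargeCompleteness` stmt-11915
applied to `f = j₀`, fed by `GibbsClustering` 11913 and `DrudeWeightExists` 11916): for `ω₂, lam, β > 0`,
`T > 0` and a symmetric Gibbs state `μ` at `T` in which NO local conservation law overlaps the current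
(`Σ_x Cov_μ(j₀, Q∘τ_x) = 0` for all local polynomial flux pairs), the current autocorrelation
`C_T(t) = Σ_x ∫ j₀ (j_x ∘ φ_t) dμ` of EVERY symmetric dynamics has ZERO CESÀRO–DRUDE WEIGHT,
`τ⁻¹ ∫₀^τ C_T → 0`. Content: Doyon's hydrodynamic projection (`D_{[j]} = ‖P_{𝒬₀}[j]‖²`, von Neumann) plus
"the conserved subspace of `ℋ₀(μ_T)` is the closure of the classes of local polynomial conserved
densities" (Doyon's completeness problem, classical pinned chain). Why it might fail: a PSEUDOLOCAL
momentum-odd invariant vector of `ℋ₀` outside that closure (long-lived breathers / KAM-like structures)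
— exactly the ballistic counterexample shape recorded on 11915. -/
def ZeroDrudeOfNoLocalOverlap : Prop :=
  ∀ ω₂ lam β γ : ℝ, 0 < ω₂ → 0 < lam → 0 < β → ∀ T : ℝ, 0 < T → ∀ μ : Measure ChainConfig,
    IsSymmetricGibbs (pinnedChain ω₂ lam β γ) T μ →
    (∀ Q G : ChainConfig → ℝ, IsLocPoly Q → IsLocPoly G → IsFluxPair (pinnedChain ω₂ lam β γ) Q G →
      form₀ μ (current₀ (pinnedChain ω₂ lam β γ)) Q = 0) →
    ∀ D : InfiniteChainDynamics (pinnedChain ω₂ lam β γ), IsSymmetricDynamics (pinnedChain ω₂ lam β γ) μ D →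
      Tendsto (fun τ : ℝ => τ⁻¹ * ∫ t in (0 : ℝ)..τ, D.currentCorrelation μ t) atTop (𝓝 0)

/-- Statement of `stub_abelWitnessOfZeroDrude` — THE ABELIAN REGULAR PART, CORNER-SEEDED (transfer
conjunct 2; THE HARDEST STUB, an honest import slot = the crux restricted to its regular branch: on a
ray whose corner `(0, T₀)` conducts, at a temperature `T` where the symmetric Gibbs state carries NO
Drude weight of the current under any symmetric dynamics, an Abelian Green–Kubo witness exists at `T`
— a DLR state (`μ` itself is intended) with a preserving dynamics, absolutely convergent `C_T`, and
`0 < κ = lim_{ν↓0} T⁻²∫₀^∞ e^{−νt} C_T < ∞`). Dischargeable by THREE outside engines, which is why it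
carries both hypotheses: `FourierGreenKubo` stmt-0703 / the Abelian reading of `GreenKuboOfNoDrude`
stmt-11029 (ignore the corner; Disproof §4b `abelWitness_of_hasGreenKubo`), the route's Mourre engine in
non-perturbative form, and the sibling modulus line heated-measure-thermal-exponent ≈
temperature-blind-vitali-hurwitz (USE the corner as the Gronwall/Vitali seed; its `K1` fails exactly at
Mazur atoms, which the zero-Drude hypothesis — this line's output — excludes). Content: existence of a
symmetric dynamics with absolutely convergent correlations (`SymmetricSetup` 11036: LLL Thm 3/4 +
Buttà–Marchioro; clustering 11913) AND regularity of the current spectral measure `σ_T` at `0` beyond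
"no atom": a finite positive symmetric derivative (Disproof §6 `no_witness_of_pseudogap`: `g_T(0) > 0`
is required, continuity is not enough). Why it might fail: `σ_T({0}) = 0` yet density `+∞` at `0`
(anomalous, `κ_A = ∞`), a pseudogap (`κ_A = 0`, asymptotic localisation DeRoeckHuveneers2015), or an
oscillating density with no Abel limit — the crux's own failure modes minus the atom. NOT the crux in
costume: it is strictly weaker (two extra hypotheses, the second being exactly what stubs 1–5 earn). -/
def AbelWitnessOfZeroDrude : Prop :=
  ∀ ω₂ lam β γ : ℝ, 0 < ω₂ → 0 < lam → 0 < β → 0 < γ → ∀ T₀ : ℝ, 0 < T₀ →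
    (∀ S : ℝ, 0 < S → S < T₀ → AbelWitness ω₂ lam β γ S) → ∀ T : ℝ, 0 < T → ∀ μ : Measure ChainConfig,
    IsSymmetricGibbs (pinnedChain ω₂ lam β γ) T μ →
    (∀ D : InfiniteChainDynamics (pinnedChain ω₂ lam β γ), IsSymmetricDynamics (pinnedChain ω₂ lam β γ) μ D →
      Tendsto (fun τ : ℝ => τ⁻¹ * ∫ t in (0 : ℝ)..τ, D.currentCorrelation μ t) atTop (𝓝 0)) →
    AbelWitness ω₂ lam β γ T

/-! ## 2. The registered stubs (the ONLY sorries of this file) -/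

/-- STUB 1 (current–charge symmetry; M, provable now). -/
theorem stub_currentChargeSymmetry :
    ∀ ω₂ lam β γ : ℝ, 0 < ω₂ → 0 < lam → 0 < β → ∀ μ : Measure ChainConfig,
      IsProbabilityMeasure μ → IsShiftInvariant μ → HasStatics (pinnedChain ω₂ lam β γ) μ →
      ∀ Q G : ChainConfig → ℝ, IsLocPoly Q → IsLocPoly G → IsFluxPair (pinnedChain ω₂ lam β γ) Q G →
        form₀ μ (current₀ (pinnedChain ω₂ lam β γ)) Q = - form₀ μ (energy₀ (pinnedChain ω₂ lam β γ)) G := by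
  sorry

/-- STUB 2 (symmetric Gibbs family: statics + fluctuation–response; L). -/
theorem stub_symmetricGibbsFamily :
    ∀ ω₂ lam β γ : ℝ, 0 < ω₂ → 0 < lam → 0 < β → ∃ μ : ℝ → Measure ChainConfig, ∀ T : ℝ, 0 < T →
      IsSymmetricGibbs (pinnedChain ω₂ lam β γ) T (μ T) ∧ HasStatics (pinnedChain ω₂ lam β γ) (μ T) ∧
      ∀ G : ChainConfig → ℝ, IsLocPoly G →
        HasDerivAt (fun S : ℝ => ∫ σ, G σ ∂(μ S))
          ((T ^ 2)⁻¹ * form₀ (μ T) (energy₀ (pinnedChain ω₂ lam β γ)) G) T := by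
  sorry

/-- STUB 3 (analyticity in `T` of local expectations, uniqueness of the translation-invariant DLR
state built in; L — the load-bearing regularity of the lever). -/
theorem stub_localExpectationAnalytic :
    ∀ ω₂ lam β γ : ℝ, 0 < ω₂ → 0 < lam → 0 < β → ∀ μ : ℝ → Measure ChainConfig,
      (∀ T : ℝ, 0 < T → (pinnedChain ω₂ lam β γ).IsChainGibbsMeasure T (μ T) ∧ IsShiftInvariant (μ T)) →
      ∀ G : ChainConfig → ℝ, IsLocPoly G →
        AnalyticOnNhd ℝ (fun T : ℝ => ∫ σ, G σ ∂(μ T)) (Ioi 0) := by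
  sorry

/-- STUB 4 (the corner is used: witness ⇒ no local-charge overlap of the current; L — Mazur/Abel in
`ℋ₀` plus the witness-state identification). -/
theorem stub_cornerOrthogonality :
    ∀ ω₂ lam β γ : ℝ, 0 < ω₂ → 0 < lam → 0 < β → 0 < γ → ∀ T : ℝ, 0 < T → AbelWitness ω₂ lam β γ T →
      ∀ μ : Measure ChainConfig, IsSymmetricGibbs (pinnedChain ω₂ lam β γ) T μ →
      ∀ Q G : ChainConfig → ℝ, IsLocPoly Q → IsLocPoly G → IsFluxPair (pinnedChain ω₂ lam β γ) Q G →
        form₀ μ (current₀ (pinnedChain ω₂ lam β γ)) Q = 0 := by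
  sorry

/-- STUB 5 (transfer conjunct 1: completeness of local charges at the current; open, shared with
stmt-11915). -/
theorem stub_zeroDrudeOfNoLocalOverlap :
    ∀ ω₂ lam β γ : ℝ, 0 < ω₂ → 0 < lam → 0 < β → ∀ T : ℝ, 0 < T → ∀ μ : Measure ChainConfig,
      IsSymmetricGibbs (pinnedChain ω₂ lam β γ) T μ →
      (∀ Q G : ChainConfig → ℝ, IsLocPoly Q → IsLocPoly G → IsFluxPair (pinnedChain ω₂ lam β γ) Q G →
        form₀ μ (current₀ (pinnedChain ω₂ lam β γ)) Q = 0) →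
      ∀ D : InfiniteChainDynamics (pinnedChain ω₂ lam β γ), IsSymmetricDynamics (pinnedChain ω₂ lam β γ) μ D →
        Tendsto (fun τ : ℝ => τ⁻¹ * ∫ t in (0 : ℝ)..τ, D.currentCorrelation μ t) atTop (𝓝 0) := by
  sorry

/-- STUB 6 (transfer conjunct 2: the Abelian regular part, corner-seeded; open — THE HARDEST, import slot
dischargeable by stmt-0703 / Abelian stmt-11029 / the Mourre engine / the modulus line). -/
theorem stub_abelWitnessOfZeroDrude :
    ∀ ω₂ lam β γ : ℝ, 0 < ω₂ → 0 < lam → 0 < β → 0 < γ → ∀ T₀ : ℝ, 0 < T₀ →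
      (∀ S : ℝ, 0 < S → S < T₀ → AbelWitness ω₂ lam β γ S) → ∀ T : ℝ, 0 < T → ∀ μ : Measure ChainConfig,
      IsSymmetricGibbs (pinnedChain ω₂ lam β γ) T μ →
      (∀ D : InfiniteChainDynamics (pinnedChain ω₂ lam β γ), IsSymmetricDynamics (pinnedChain ω₂ lam β γ) μ D →
        Tendsto (fun τ : ℝ => τ⁻¹ * ∫ t in (0 : ℝ)..τ, D.currentCorrelation μ t) atTop (𝓝 0)) →
      AbelWitness ω₂ lam β γ T := by
  sorry

/-! ## 3. Sorry-free composition: the identity theorem on `(0, ∞)` -/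

/-- **OVERLAP RIGIDITY, energy face** (sorry-free): along a symmetric Gibbs family with the
fluctuation–response formula, whose local expectations are analytic, corner witnesses on `(0, T₀)`
force `Σ_x Cov_{μ_T}(h₀, G ∘ τ_x) = 0` at EVERY `T > 0` for every local flux pair `(Q, G)`:
`d⟨G⟩_S/dS = S⁻²·⟨h₀,G⟩₀ = −S⁻²·⟨j₀,Q⟩₀ = 0` on the corner (stubs 4 and 1), the derivative of the
analytic function `S ↦ ⟨G⟩_S` is analytic and vanishes near `T₀/2`, hence on the preconnected ray
(`AnalyticOnNhd.eqOn_zero_of_preconnected_of_eventuallyEq_zero`), and `T⁻² ≠ 0`. -/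
theorem form₀_energy_flux_eq_zero {ω₂ lam β γ T₀ : ℝ} (hω : 0 < ω₂) (hl : 0 < lam) (hβ : 0 < β)
    (hγ : 0 < γ) (hT₀ : 0 < T₀)
    (h1 : CurrentChargeSymmetry) (h3 : LocalExpectationAnalytic) (h4 : CornerOrthogonality)
    {μ : ℝ → Measure ChainConfig}
    (hμ : ∀ T : ℝ, 0 < T →
      IsSymmetricGibbs (pinnedChain ω₂ lam β γ) T (μ T) ∧ HasStatics (pinnedChain ω₂ lam β γ) (μ T) ∧
      ∀ G : ChainConfig → ℝ, IsLocPoly G →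
        HasDerivAt (fun S : ℝ => ∫ σ, G σ ∂(μ S))
          ((T ^ 2)⁻¹ * form₀ (μ T) (energy₀ (pinnedChain ω₂ lam β γ)) G) T)
    (hcorner : ∀ T : ℝ, 0 < T → T < T₀ → AbelWitness ω₂ lam β γ T)
    {Q G : ChainConfig → ℝ} (hQ : IsLocPoly Q) (hG : IsLocPoly G)
    (hQG : IsFluxPair (pinnedChain ω₂ lam β γ) Q G) :
    ∀ T : ℝ, 0 < T → form₀ (μ T) (energy₀ (pinnedChain ω₂ lam β γ)) G = 0 := by
  -- analyticity of the local expectation along the family, and its derivative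
  have hana : AnalyticOnNhd ℝ (fun S : ℝ => ∫ σ, G σ ∂(μ S)) (Ioi 0) :=
    h3 ω₂ lam β γ hω hl hβ μ (fun S hS => ⟨(hμ S hS).1.1, (hμ S hS).1.2.1⟩) G hG
  have hder : ∀ S : ℝ, 0 < S → HasDerivAt (fun S : ℝ => ∫ σ, G σ ∂(μ S))
      ((S ^ 2)⁻¹ * form₀ (μ S) (energy₀ (pinnedChain ω₂ lam β γ)) G) S :=
    fun S hS => (hμ S hS).2.2 G hG
  -- on the corner the energy face of the overlap vanishes (stub 4, then stub 1)
  have hcz : ∀ S : ℝ, 0 < S → S < T₀ → form₀ (μ S) (energy₀ (pinnedChain ω₂ lam β γ)) G = 0 := by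
    intro S hS hST
    have hsg : IsSymmetricGibbs (pinnedChain ω₂ lam β γ) S (μ S) := (hμ S hS).1
    have hjQ : form₀ (μ S) (current₀ (pinnedChain ω₂ lam β γ)) Q = 0 :=
      h4 ω₂ lam β γ hω hl hβ hγ S hS (hcorner S hS hST) (μ S) hsg Q G hQ hG hQG
    have hprob : IsProbabilityMeasure (μ S) := hsg.1.isProbabilityMeasure
    have hsym : form₀ (μ S) (current₀ (pinnedChain ω₂ lam β γ)) Q =
        - form₀ (μ S) (energy₀ (pinnedChain ω₂ lam β γ)) G :=
      h1 ω₂ lam β γ hω hl hβ (μ S) hprob hsg.2.1 (hμ S hS).2.1 Q G hQ hG hQG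
    linarith
  -- the derivative is analytic on the ray and vanishes near T₀/2, hence everywhere on the ray
  have hdan : AnalyticOnNhd ℝ (deriv fun S : ℝ => ∫ σ, G σ ∂(μ S)) (Ioi 0) := hana.deriv
  have hz : T₀ / 2 ∈ Ioi (0 : ℝ) := mem_Ioi.mpr (half_pos hT₀)
  have hev : (deriv fun S : ℝ => ∫ σ, G σ ∂(μ S)) =ᶠ[𝓝 (T₀ / 2)] 0 := by
    have hmem : Ioo 0 T₀ ∈ 𝓝 (T₀ / 2) := Ioo_mem_nhds (half_pos hT₀) (half_lt_self hT₀)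
    filter_upwards [hmem] with S hS
    rw [Pi.zero_apply, (hder S hS.1).deriv, hcz S hS.1 hS.2, mul_zero]
  have hEq : EqOn (deriv fun S : ℝ => ∫ σ, G σ ∂(μ S)) 0 (Ioi 0) :=
    hdan.eqOn_zero_of_preconnected_of_eventuallyEq_zero isPreconnected_Ioi hz hev
  intro T hT
  have h₁ : deriv (fun S : ℝ => ∫ σ, G σ ∂(μ S)) T =
      (T ^ 2)⁻¹ * form₀ (μ T) (energy₀ (pinnedChain ω₂ lam β γ)) G := (hder T hT).deriv
  have h₂ : deriv (fun S : ℝ => ∫ σ, G σ ∂(μ S)) T = 0 := hEq hT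
  have h₃ : (T ^ 2)⁻¹ * form₀ (μ T) (energy₀ (pinnedChain ω₂ lam β γ)) G = 0 := h₁.symm.trans h₂
  have hT2 : (T ^ 2)⁻¹ ≠ 0 := inv_ne_zero (pow_ne_zero 2 hT.ne')
  exact (mul_eq_zero.mp h₃).resolve_left hT2

/-- **NO LOCAL OVERLAP AT ANY TEMPERATURE** (`NoLocalOverlapAllT`, the line's own deliverable;
sorry-free from stubs 1, 3, 4 and the family of stub 2): for every local conservation law
`𝒜Q = G ∘ shift − G`, `Σ_x Cov_{μ_T}(j₀, Q ∘ τ_x) = 0` at every `T > 0`. -/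
theorem noLocalOverlap_allT {ω₂ lam β γ T₀ : ℝ} (hω : 0 < ω₂) (hl : 0 < lam) (hβ : 0 < β)
    (hγ : 0 < γ) (hT₀ : 0 < T₀)
    (h1 : CurrentChargeSymmetry) (h3 : LocalExpectationAnalytic) (h4 : CornerOrthogonality)
    {μ : ℝ → Measure ChainConfig}
    (hμ : ∀ T : ℝ, 0 < T →
      IsSymmetricGibbs (pinnedChain ω₂ lam β γ) T (μ T) ∧ HasStatics (pinnedChain ω₂ lam β γ) (μ T) ∧
      ∀ G : ChainConfig → ℝ, IsLocPoly G →
        HasDerivAt (fun S : ℝ => ∫ σ, G σ ∂(μ S))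
          ((T ^ 2)⁻¹ * form₀ (μ T) (energy₀ (pinnedChain ω₂ lam β γ)) G) T)
    (hcorner : ∀ T : ℝ, 0 < T → T < T₀ → AbelWitness ω₂ lam β γ T)
    {Q G : ChainConfig → ℝ} (hQ : IsLocPoly Q) (hG : IsLocPoly G)
    (hQG : IsFluxPair (pinnedChain ω₂ lam β γ) Q G) :
    ∀ T : ℝ, 0 < T → form₀ (μ T) (current₀ (pinnedChain ω₂ lam β γ)) Q = 0 := by
  intro T hT
  have hE := form₀_energy_flux_eq_zero hω hl hβ hγ hT₀ h1 h3 h4 hμ hcorner hQ hG hQG T hT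
  have hprob : IsProbabilityMeasure (μ T) := (hμ T hT).1.1.isProbabilityMeasure
  rw [h1 ω₂ lam β γ hω hl hβ (μ T) hprob (hμ T hT).1.2.1 (hμ T hT).2.1 Q G hQ hG hQG, hE, neg_zero]

/-- **THE LINE, COMPOSED** (sorry-free): the six statements give continuation of `AbelWitness` from
every corner — overlap rigidity (stubs 1–4) removes every local-charge overlap at `T`, the transfer
(stubs 5–6) turns that into a witness at `T`. -/
theorem continuesAlong_of_parts (h1 : CurrentChargeSymmetry) (h2 : SymmetricGibbsFamily)
    (h3 : LocalExpectationAnalytic) (h4 : CornerOrthogonality) (h5 : ZeroDrudeOfNoLocalOverlap)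
    (h6 : AbelWitnessOfZeroDrude) {ω₂ lam β γ : ℝ} (hω : 0 < ω₂) (hl : 0 < lam) (hβ : 0 < β)
    (hγ : 0 < γ) {T₀ : ℝ} (hT₀ : 0 < T₀)
    (hcorner : ∀ T : ℝ, 0 < T → T < T₀ → AbelWitness ω₂ lam β γ T) {T : ℝ} (hT : 0 < T) :
    AbelWitness ω₂ lam β γ T := by
  obtain ⟨μ, hμ⟩ := h2 ω₂ lam β γ hω hl hβ
  have hNo : ∀ Q G : ChainConfig → ℝ, IsLocPoly Q → IsLocPoly G →
      IsFluxPair (pinnedChain ω₂ lam β γ) Q G → form₀ (μ T) (current₀ (pinnedChain ω₂ lam β γ)) Q = 0 :=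
    fun Q G hQ hG hQG => noLocalOverlap_allT hω hl hβ hγ hT₀ h1 h3 h4 hμ hcorner hQ hG hQG T hT
  exact h6 ω₂ lam β γ hω hl hβ hγ T₀ hT₀ hcorner T hT (μ T) (hμ T hT).1 fun D hD =>
    h5 ω₂ lam β γ hω hl hβ T hT (μ T) (hμ T hT).1 hNo D hD

/-! ## 4. The skeleton theorem (concludes the crux BY NAME; sorries only via the stubs) -/

/-- **Statement-level wiring** (sorry-free): the six STATEMENTS imply the crux — the arrow form of the
skeleton over the statement `def`s (it concludes the `ContinuesAlong` unfolding, not the route decl,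
so that exactly one theorem of this file concludes the crux by name). -/
theorem continuesAlong_of_statements (h1 : CurrentChargeSymmetry) (h2 : SymmetricGibbsFamily)
    (h3 : LocalExpectationAnalytic) (h4 : CornerOrthogonality) (h5 : ZeroDrudeOfNoLocalOverlap)
    (h6 : AbelWitnessOfZeroDrude) :
    ∀ ω₂ lam β γ : ℝ, 0 < ω₂ → 0 < lam → 0 < β → 0 < γ → ∀ T₀ : ℝ, 0 < T₀ →
      (∀ T : ℝ, 0 < T → T < T₀ → AbelWitness ω₂ lam β γ T) → ∀ T : ℝ, 0 < T → AbelWitness ω₂ lam β γ T :=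
  fun _ω₂ _lam _β _γ hω hl hβ hγ _T₀ hT₀ hcorner _T hT =>
    continuesAlong_of_parts h1 h2 h3 h4 h5 h6 hω hl hβ hγ hT₀ hcorner hT

/-- **`GreenKuboContinuation_of`** — the registered skeleton: the crux
`Summit.AtomisticToContinuum.FouriersLaw.Theses.EmbeddedDrudeMourre.GreenKuboContinuation`
(stmt-AtomisticToContinuum-12597) from the six declared stubs through the sorry-free composition
`continuesAlong_of_statements` (A12 shape: no hypotheses; the only open obligations are the `stub_*`
declarations, by name; axiom closure `{propext, Classical.choice, Quot.sound} ∪ {sorryAx via the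
stubs}`). The stubs are fed into the statement-typed slots, which certifies that each inline stub
signature IS the documented statement `def`. -/
theorem GreenKuboContinuation_of :
    Summit.AtomisticToContinuum.FouriersLaw.Theses.EmbeddedDrudeMourre.GreenKuboContinuation :=
  greenKuboContinuation_iff_continuesAlong.2
    (continuesAlong_of_statements stub_currentChargeSymmetry stub_symmetricGibbsFamily
      stub_localExpectationAnalytic stub_cornerOrthogonality stub_zeroDrudeOfNoLocalOverlap
      stub_abelWitnessOfZeroDrude)

/-! ## 5. Certified bounds on the hardest stub (sorry-free)

`stub_abelWitnessOfZeroDrude` sits BETWEEN two registered statements: it is implied by the crux itself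
(so it is not stronger than what the route asks — given stubs 1–5 the crux is EQUIVALENT to its
regular branch) and by `FourierGreenKubo` (stmt-AtomisticToContinuum-0703; provers of 0703 discharge
it with `abelWitnessOfZeroDrude_of_fourierGreenKubo`). -/

/-- The crux implies the regular-branch stub (drop the two extra hypotheses): modulo stubs 1–5,
`GreenKuboContinuation ↔ AbelWitnessOfZeroDrude`. -/
theorem abelWitnessOfZeroDrude_of_greenKuboContinuation (h : GreenKuboContinuation) :
    AbelWitnessOfZeroDrude :=
  fun ω₂ lam β γ hω hl hβ hγ T₀ hT₀ hcorner T hT _μ _hμ _hD =>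
    h ω₂ lam β γ hω hl hβ hγ T₀ hT₀ hcorner T hT

/-- `FourierGreenKubo` (stmt-0703: an `L¹` Green–Kubo pair at a Gibbs state at every `T`) implies the
regular-branch stub, ignoring both of its hypotheses (tree
`InfiniteChainDynamics.HasGreenKubo.tendsto_abel`: dominated convergence). -/
theorem abelWitnessOfZeroDrude_of_fourierGreenKubo
    (h : Summit.AtomisticToContinuum.FouriersLaw.Theses.FourierGreenKubo.FourierGreenKubo) :
    AbelWitnessOfZeroDrude := by
  intro ω₂ lam β γ hω hl hβ hγ T₀ _hT₀ _hcorner T hT _μ _hμ _hD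
  obtain ⟨μ, hG, D, hP, hGK⟩ := h ω₂ lam β γ hω hl hβ hγ T hT
  exact ⟨μ, D, D.greenKuboConductivity μ T, hG, hP, hGK.1, hGK.pos, hGK.tendsto_abel⟩

end Summit.AtomisticToContinuum.FouriersLaw.Cruxes.GreenKuboContinuation.OverlapRigidityAnalyticContinuation

end
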